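import Mathlib
import Summits.PneNP.PneNP.Theses.PhaseTwins
import Literature.Computability.Complexity.HardcoreInapproximabilityProofs

/-!
# Sketch — crux idea `annealed-cover-twins` for `PolyDepthTwinsAbove` (stmt-PneNP-2719)

First checkable statements of the line (crux-ideate r1, ideator 3).

* `exists_twin_of_sum_le` — THE LEVER in its barest form: if the first moments satisfy
  `2·Σ_r Z(H_r) ≤ Σ_r Z(G_r)` over a finite family of samples `r`, some sample has
  `2·Z(H_r) ≤ Z(G_r)`.  (Proved.)
* `twins_of_annealed` — the composition step the line uses: samplewise max-degree and samplewise
  hom-indistinguishability (both DETERMINISTIC in the gadget randomness) plus the ANNEALED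
  inequality give the inner existential of `PolyDepthTwinsAbove` verbatim.  (Proved.)
* `fpfInv`, `coverCore` — the deck-symmetric random gadget: the bipartite double cover of the
  multigraph `R_σ = M_1 ∪ … ∪ M_d` of `d` fixed-point-free involutions (perfect matchings) of
  `Fin n'`; `coverCore_swap` — the deck involution is an automorphism for EVERY sample (this is
  what makes the CFI gauge shift a graph isomorphism without a second copy of the gadget).
* `OverlapAveraging` — first lemma (A), finite and exact: averaging the matching-avoidance count
  over the position of `I₁` reproduces the permutation-model (MWW/Sly) avoidance probability
  `C(n'-a, b)/C(n', b)`; it is the `d = 1` shadow of the numerical identity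
  `Λ(Bern(α)⊗Bern(β)) = Φ₁(α, β)` (scratch/ac2.py).
* `CoverDecoupling` — first lemma (B), the one genuinely new inequality (numerically verified for
  `d ≤ 100`): the annealed exponent of the cover gadget never exceeds `max Φ₁` (tree:
  `slyPhi1`), i.e. correlated overlap profiles do not beat product profiles.
-/

namespace Summit.PneNP.PneNP.Cruxes.PolyDepthTwinsAbove.AnnealedCoverTwins

open Finset
open scoped BigOperators Classical

/-- The crux's inlined hard-core sum `Z_G(λ) = Σ_{I independent} λ^{|I|}` on `Fin n`. -/
noncomputable def zsum {n : ℕ} (G : SimpleGraph (Fin n)) (lam : ℝ) : ℝ :=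
  ∑ I : Finset (Fin n), (if G.IsIndepSet (↑I : Set (Fin n)) then lam ^ I.card else 0)

/-- **The lever (averaging principle).** A first-moment inequality over a finite family of
samples already produces ONE sample with the twin inequality — no second moment, no
concentration. -/
theorem exists_twin_of_sum_le {ι : Type*} (s : Finset ι) (hs : s.Nonempty) (Z₀ Z₁ : ι → ℝ)
    (h : 2 * ∑ r ∈ s, Z₁ r ≤ ∑ r ∈ s, Z₀ r) : ∃ r ∈ s, 2 * Z₁ r ≤ Z₀ r := by
  by_contra hcon
  push Not at hcon
  have hlt : ∑ r ∈ s, Z₀ r < ∑ r ∈ s, 2 * Z₁ r :=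
    Finset.sum_lt_sum_of_nonempty hs (fun r hr => hcon r hr)
  rw [← Finset.mul_sum] at hlt
  linarith

/-- **Composition step of the line.** Samplewise degree bounds and samplewise
hom-indistinguishability below depth `k` (both hold for EVERY gadget sample, because the CFI
gauge shift is an isomorphism for every sample) plus the ANNEALED twin inequality
`2·Σ_r Z(H_r) ≤ Σ_r Z(G_r)` give a twin pair in the exact shape of the inner existential of
`Summit.PneNP.PneNP.Theses.PhaseTwins.PolyDepthTwinsAbove`. -/
theorem twins_of_annealed {ι : Type*} (s : Finset ι) (hs : s.Nonempty) {n Δ : ℕ} (k lam : ℝ)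
    (G H : ι → SimpleGraph (Fin n))
    (hG : ∀ r ∈ s, (G r).maxDegree ≤ Δ) (hH : ∀ r ∈ s, (H r).maxDegree ≤ Δ)
    (hequiv : ∀ r ∈ s, ∀ (m : ℕ) (F : SimpleGraph (Fin m)),
      (Literature.Combinatorics.SimpleGraph.treewidth F : ℝ) < k →
        Nat.card (F →g G r) = Nat.card (F →g H r))
    (hmoment : 2 * ∑ r ∈ s, zsum (H r) lam ≤ ∑ r ∈ s, zsum (G r) lam) :
    ∃ G' H' : SimpleGraph (Fin n), G'.maxDegree ≤ Δ ∧ H'.maxDegree ≤ Δ ∧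
      (∀ (m : ℕ) (F : SimpleGraph (Fin m)),
        (Literature.Combinatorics.SimpleGraph.treewidth F : ℝ) < k →
          Nat.card (F →g G') = Nat.card (F →g H')) ∧
      2 * zsum H' lam ≤ zsum G' lam := by
  obtain ⟨r, hr, hle⟩ := exists_twin_of_sum_le s hs (fun r => zsum (G r) lam)
    (fun r => zsum (H r) lam) hmoment
  exact ⟨G r, H r, hG r hr, hH r hr, hequiv r hr, hle⟩

/-- Fixed-point-free involutions of a finite type (= its perfect matchings, as permutations). -/
def fpfInv (α : Type*) [DecidableEq α] [Fintype α] : Finset (Equiv.Perm α) :=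
  Finset.univ.filter fun σ => (∀ x, σ (σ x) = x) ∧ ∀ x, σ x ≠ x

/-- The random multigraph `R_σ = M_1 ∪ ⋯ ∪ M_d` on `Fin n'` given by `d` fixed-point-free
involutions, as a simple graph (multiplicities forgotten — independent sets do not see them). -/
def matchUnion {n' d : ℕ} (σ : Fin d → Equiv.Perm (Fin n')) : SimpleGraph (Fin n') :=
  SimpleGraph.fromRel fun x y => ∃ i, σ i x = y

/-- **The deck-symmetric gadget core**: the bipartite double cover `R_σ × K₂` on
`Fin n' ⊕ Fin n'` (side `inl` = torsor value `0`, side `inr` = torsor value `1`). -/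
def coverCore {n' d : ℕ} (σ : Fin d → Equiv.Perm (Fin n')) : SimpleGraph (Fin n' ⊕ Fin n') :=
  (matchUnion σ).bipartiteDoubleCover

/-- The deck involution `inl x ↔ inr x` is an automorphism of the cover core for EVERY sample
`σ` — the symmetry that realises the CFI gauge shift at an edge as a graph isomorphism with a
single gadget per base edge (no second copy, hence no two-replica moment). -/
theorem coverCore_swap {n' d : ℕ} (σ : Fin d → Equiv.Perm (Fin n')) (u v : Fin n' ⊕ Fin n') :
    (coverCore σ).Adj (u.swap) (v.swap) ↔ (coverCore σ).Adj u v := by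
  rcases u with x | x <;> rcases v with y | y <;>
    simp [coverCore, SimpleGraph.bipartiteDoubleCover, Sum.swap]

/-- **First lemma (A) — overlap averaging, exact.** For a fixed `I₀ ⊆ Fin n'` with `|I₀| = a`,
summing the number of perfect matchings with no pair between `I₀` and `I₁` over all `I₁` with
`|I₁| = b` gives `C(n' - a, b) · #(perfect matchings)`: swap the sums and use `|σ(I₀)| = a`.
Hence the overlap-AVERAGED avoidance probability of the cover gadget equals the permutation-model
probability `C(n'-a,b)/C(n',b) = C(n'-b,a)/C(n',a)` of `card_perm_filter_forall_not_mem`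
(tree, PROVED) — the `d = 1` case of "annealed cover exponent on product profiles = Φ₁". -/
def OverlapAveraging : Prop :=
  ∀ (n' a b : ℕ) (I₀ : Finset (Fin n')), I₀.card = a →
    ∑ I₁ ∈ (Finset.univ : Finset (Fin n')).powersetCard b,
        ((fpfInv (Fin n')).filter fun σ => ∀ x ∈ I₀, σ x ∉ I₁).card =
      (n' - a).choose b * (fpfInv (Fin n')).card

/-- `x log x` (with Mathlib's `Real.log 0 = 0`, so `xlogx 0 = 0`). -/
noncomputable def xlogx (x : ℝ) : ℝ := x * Real.log x

/-- The entropy part of the annealed exponent of the cover gadget at a type profile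
`ν = (ν₀₀, ν₁₀, ν₀₁, ν₁₁)` (types `(s₀, s₁)` = occupied in layer 0 / layer 1) and allowed
pair-type frequencies: free variables `u = q_{00,10}`, `v = q_{00,01}`; the other allowed
frequencies are forced: `q_{10,10} = (ν₁₀-u)/2`, `q_{01,01} = (ν₀₁-v)/2`, `q_{00,11} = ν₁₁`,
`q_{00,00} = (ν₀₀-u-v-ν₁₁)/2` (forbidden pairs `{10,01},{10,11},{01,11},{11,11}`). -/
noncomputable def coverPsi (ν₀₀ ν₁₀ ν₀₁ ν₁₁ u v : ℝ) : ℝ :=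
  (-(xlogx u + xlogx v + xlogx ν₁₁))
    - (xlogx ((ν₁₀ - u) / 2) + (ν₁₀ - u) / 2 * Real.log 2)
    - (xlogx ((ν₀₁ - v) / 2) + (ν₀₁ - v) / 2 * Real.log 2)
    - (xlogx ((ν₀₀ - u - v - ν₁₁) / 2) + (ν₀₀ - u - v - ν₁₁) / 2 * Real.log 2)

/-- The annealed exponent `Λ_{d,λ}(ν; u, v)` of `E_σ Z(coverCore σ, λ)` at type profile `ν` and
pair profile `(u, v)`: `(1/n') log` of (number of type assignments) × `λ`-weight ×
(avoidance probability)^d, `= (d-1) Σ_s ν_s log ν_s + (ν₁₀+ν₀₁+2ν₁₁) log λ + d·coverPsi`. -/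
noncomputable def coverLambda (d : ℕ) (lam ν₀₀ ν₁₀ ν₀₁ ν₁₁ u v : ℝ) : ℝ :=
  ((d : ℝ) - 1) * (xlogx ν₀₀ + xlogx ν₁₀ + xlogx ν₀₁ + xlogx ν₁₁)
    + (ν₁₀ + ν₀₁ + 2 * ν₁₁) * Real.log lam
    + (d : ℝ) * coverPsi ν₀₀ ν₁₀ ν₀₁ ν₁₁ u v

/-- **First lemma (B) — overlap decoupling** (the one genuinely new inequality of the line;
numerically verified on a grid + random restarts for `d ∈ {3,…,100}` at activities from
`1.01·λ_c(d)` to `10³`, scratch/ac2.py): the annealed exponent of the deck-symmetric cover gadget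
never exceeds the maximum of Sly's bipartite first-moment exponent `Φ₁ = slyPhi1 d λ` (tree:
`slyPhi1_max_triangle`, PROVED, puts that maximum at the two phase points `(p⁺,p⁻), (p⁻,p⁺)` for
`λ > λ_c(𝕋_d)`), and it is attained exactly on product profiles `ν = Bern(α) ⊗ Bern(β)`. -/
def CoverDecoupling : Prop :=
  ∀ (d : ℕ), 3 ≤ d → ∀ lam : ℝ, 0 < lam →
    ∀ ν₁₀ ν₀₁ ν₁₁ u v : ℝ, 0 ≤ ν₁₀ → 0 ≤ ν₀₁ → 0 ≤ ν₁₁ → ν₁₀ + ν₀₁ + ν₁₁ ≤ 1 →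
      0 ≤ u → u ≤ ν₁₀ → 0 ≤ v → v ≤ ν₀₁ → u + v + ν₁₁ ≤ 1 - ν₁₀ - ν₀₁ - ν₁₁ →
        ∃ α β : ℝ, 0 ≤ α ∧ 0 ≤ β ∧ α + β ≤ 1 ∧
          coverLambda d lam (1 - ν₁₀ - ν₀₁ - ν₁₁) ν₁₀ ν₀₁ ν₁₁ u v ≤
            Literature.Computability.Complexity.slyPhi1 d lam α β

end Summit.PneNP.PneNP.Cruxes.PolyDepthTwinsAbove.AnnealedCoverTwins
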